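import Summits.ABC.ABC.Theses.CuspFieldPencil
import HarnessLib

/-!
# The five-torsion payoff: golden cusp shadow + dictionary ⇒ class ε-shape on 𝒯₅

`Summits/ABC/ABC/Theorems/CuspFieldPencilFiveTorsionPayoff.lean` — proves the support item
stmt-ABC-26029 `Summit.ABC.ABC.Theses.CuspFieldPencil.FiveTorsionPayoff` of the (draft)
class-record route `CuspFieldPencil` (abc-idea-2 g2):

`GoldenCuspShadow → FiveTorsionDictionary → FiveTorsionClassEpsShape`.

**Proof** (real arithmetic only). Fix `ε > 0`; X1 gives `κ` with
`log max(|u|,|w|) ≤ κ · rad(uwQ)^{1/2+ε}` (`Q = u² − 11uw − w²`). For coprime `u, w` with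
`uwQ ≠ 0` and `W = ⟨w−u, −uw, −uw², 0, 0⟩ / ℚ` elliptic, the dictionary gives
`|Δ_min(W)| ≤ |u⁵w⁵Q|` and `rad(uwQ) ∣ 5·N_W`. With `M = max(|u|,|w|) ≥ 1` (as `u ≠ 0`):
`|u⁵w⁵Q| ≤ 13·M¹²` (`|Q| ≤ |u|² + 11|u||w| + |w|² ≤ 13M²`), so
`log|Δ_min| ≤ log 13 + 12·log M ≤ log 13 + 12κ⁺·rad^{1/2+ε} ≤ log 13 + 12κ⁺·(5N)^{1/2+ε}
 ≤ (12κ⁺·5^{1/2+ε} + log 13)·N^{1/2+ε}` (`κ⁺ = max κ 0`, `N ≥ 1`), i.e. `C = 12κ⁺5^{1/2+ε} + log 13`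
(depending on `ε` through `κ` and `5^{1/2+ε}`).

HONESTY. Bookkeeping theorem of a CLASS RECORD at abc distance 0: it moves no rung of LADDER-ABC
(width 0); the class ε-shape `FiveTorsionClassEpsShape` is NOT abc, NOT A-PS; the load-bearing
crux X1 `GoldenCuspShadow` stays open; abc moved by 0; typed ≠ proved.

References: [SilvermanAEC2009] VII.1 Remark 1.1, VIII.11 (only through the dictionary hypothesis).
-/

set_option linter.dupNamespace false

namespace Summit.ABC.ABC.Theorems

open UniqueFactorizationMonoid

namespace FiveTorsionPayoff

/-- The quadratic cusp form is bounded by `13 M²`, `M = max(|u|,|w|)`: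
`|u² − 11uw − w²| ≤ 13 · max(|u|,|w|)²`. [folklore] -/
theorem abs_quadForm_le (u w : ℝ) :
    |u ^ 2 - 11 * u * w - w ^ 2| ≤ 13 * (max |u| |w|) ^ 2 := by
  set M : ℝ := max |u| |w| with hM
  have hu : |u| ≤ M := le_max_left _ _
  have hw : |w| ≤ M := le_max_right _ _
  have hu0 : 0 ≤ |u| := abs_nonneg _
  have hw0 : 0 ≤ |w| := abs_nonneg _
  have h1 : |u ^ 2 - 11 * u * w - w ^ 2| ≤ |u| ^ 2 + 11 * |u| * |w| + |w| ^ 2 := by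
    calc |u ^ 2 - 11 * u * w - w ^ 2|
        ≤ |u ^ 2 - 11 * u * w| + |w ^ 2| := abs_sub _ _
      _ ≤ (|u ^ 2| + |11 * u * w|) + |w ^ 2| := by gcongr; exact abs_sub _ _
      _ = |u| ^ 2 + 11 * |u| * |w| + |w| ^ 2 := by
          rw [abs_pow, abs_pow, abs_mul, abs_mul, abs_of_pos (by norm_num : (0 : ℝ) < 11)]
  have h2 : |u| ^ 2 + 11 * |u| * |w| + |w| ^ 2 ≤ 13 * M ^ 2 := by
    have hu2 : |u| ^ 2 ≤ M ^ 2 := pow_le_pow_left₀ hu0 hu 2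
    have hw2 : |w| ^ 2 ≤ M ^ 2 := pow_le_pow_left₀ hw0 hw 2
    have huw : |u| * |w| ≤ M * M := mul_le_mul hu hw hw0 (hu0.trans hu)
    nlinarith [huw, hu2, hw2]
  exact h1.trans h2

/-- The discriminant form is bounded by `13 M¹²`:
`|u⁵ w⁵ (u² − 11uw − w²)| ≤ 13 · max(|u|,|w|)¹²`. [folklore] -/
theorem abs_discForm_le (u w : ℝ) :
    |u ^ 5 * w ^ 5 * (u ^ 2 - 11 * u * w - w ^ 2)| ≤ 13 * (max |u| |w|) ^ 12 := by
  set M : ℝ := max |u| |w| with hM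
  have hu : |u| ≤ M := le_max_left _ _
  have hw : |w| ≤ M := le_max_right _ _
  have hu0 : 0 ≤ |u| := abs_nonneg _
  have hM0 : 0 ≤ M := hu0.trans hu
  have hQ := abs_quadForm_le u w
  rw [← hM] at hQ
  calc |u ^ 5 * w ^ 5 * (u ^ 2 - 11 * u * w - w ^ 2)|
      = |u| ^ 5 * |w| ^ 5 * |u ^ 2 - 11 * u * w - w ^ 2| := by
        rw [abs_mul, abs_mul, abs_pow, abs_pow]
    _ ≤ M ^ 5 * M ^ 5 * (13 * M ^ 2) := by gcongr
    _ = 13 * M ^ 12 := by ring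

/-- Logarithmic form: if `0 ≤ d ≤ |u⁵w⁵Q|` and `u ≠ 0` is an integer (so `max(|u|,|w|) ≥ 1`), then
`log d ≤ log 13 + 12 · log max(|u|,|w|)` (with Mathlib's `log 0 = 0`). [folklore] -/
theorem log_le_of_le_abs_discForm {u w : ℤ} (hu : u ≠ 0) {d : ℝ} (hd0 : 0 ≤ d)
    (hd : d ≤ |(u : ℝ) ^ 5 * (w : ℝ) ^ 5 * ((u : ℝ) ^ 2 - 11 * (u : ℝ) * (w : ℝ) - (w : ℝ) ^ 2)|) :
    Real.log d ≤ Real.log 13 + 12 * Real.log (max |(u : ℝ)| |(w : ℝ)|) := by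
  set M : ℝ := max |(u : ℝ)| |(w : ℝ)| with hM
  have h1u : (1 : ℝ) ≤ |(u : ℝ)| := by exact_mod_cast Int.one_le_abs hu
  have hM1 : 1 ≤ M := h1u.trans (le_max_left _ _)
  have hM0 : 0 < M := one_pos.trans_le hM1
  have hlogM : 0 ≤ Real.log M := Real.log_nonneg hM1
  have hlog13 : 0 ≤ Real.log 13 := Real.log_nonneg (by norm_num)
  rcases hd0.eq_or_lt with hd00 | hdpos
  · -- `d = 0`: `log 0 = 0`
    rw [← hd00, Real.log_zero]
    positivity
  · have hbound : d ≤ 13 * M ^ 12 := hd.trans (abs_discForm_le (u : ℝ) (w : ℝ))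
    calc Real.log d ≤ Real.log (13 * M ^ 12) := Real.log_le_log hdpos hbound
      _ = Real.log 13 + 12 * Real.log M := by
          rw [Real.log_mul (by norm_num) (pow_ne_zero _ hM0.ne'), Real.log_pow]
          push_cast
          ring

/-- The radical-to-conductor transfer in real form: if `r ∣ 5·N` in `ℕ` with `N > 0`, then for
every exponent `e ≥ 0`, `(r : ℝ) ^ e ≤ 5 ^ e · (N : ℝ) ^ e`. [folklore] -/
theorem rpow_le_of_dvd_five_mul {r N : ℕ} (hN : 0 < N) (h : r ∣ 5 * N) {e : ℝ} (he : 0 ≤ e) :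
    ((r : ℕ) : ℝ) ^ e ≤ (5 : ℝ) ^ e * ((N : ℕ) : ℝ) ^ e := by
  have hle : r ≤ 5 * N := Nat.le_of_dvd (by omega) h
  have hcast : ((r : ℕ) : ℝ) ≤ 5 * ((N : ℕ) : ℝ) := by exact_mod_cast hle
  calc ((r : ℕ) : ℝ) ^ e ≤ (5 * ((N : ℕ) : ℝ)) ^ e :=
        Real.rpow_le_rpow (Nat.cast_nonneg _) hcast he
    _ = (5 : ℝ) ^ e * ((N : ℕ) : ℝ) ^ e := Real.mul_rpow (by norm_num) (Nat.cast_nonneg _)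

end FiveTorsionPayoff

/-- **stmt-ABC-26029 `FiveTorsionPayoff` of route `CuspFieldPencil`**:
`GoldenCuspShadow → FiveTorsionDictionary → FiveTorsionClassEpsShape` — X1 plus the dictionary give
the class ε-shape `log|Δ_min(W)| ≤ C·N_W^{1/2+ε}` on the rational-5-torsion class, with
`C = 12·max(κ,0)·5^{1/2+ε} + log 13`. Real-arithmetic bookkeeping for a class record at abc
distance 0; X1 stays open (nothing here proves `FiveTorsionClassEpsShape` itself); NOT abc, NOT
A-PS, moves no rung. [folklore] -/
theorem fiveTorsionPayoff_proof :
    Summit.ABC.ABC.Theses.CuspFieldPencil.FiveTorsionPayoff := by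
  unfold Summit.ABC.ABC.Theses.CuspFieldPencil.FiveTorsionPayoff
    Summit.ABC.ABC.Theses.CuspFieldPencil.GoldenCuspShadow
    Summit.ABC.ABC.Theses.CuspFieldPencil.FiveTorsionDictionary
    Summit.ABC.ABC.Theses.CuspFieldPencil.FiveTorsionClassEpsShape
  intro hX hD ε hε
  obtain ⟨κ, hκ⟩ := hX ε hε
  set e : ℝ := 1 / 2 + ε with he
  have he0 : 0 ≤ e := by rw [he]; positivity
  set κ' : ℝ := max κ 0 with hκ'
  have hκ'0 : 0 ≤ κ' := le_max_right _ _
  refine ⟨12 * κ' * (5 : ℝ) ^ e + Real.log 13, ?_⟩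
  intro u w huw h0 W _ hW
  obtain ⟨hΔ, hdiv⟩ := hD u w huw h0 W hW
  have hlogM := hκ u w huw h0
  -- names
  set M : ℝ := max |(u : ℝ)| |(w : ℝ)| with hM
  set R : ℝ := (((radical (u * w * (u ^ 2 - 11 * u * w - w ^ 2))).natAbs : ℕ) : ℝ) with hR
  set N : ℕ := W.conductorNorm ℤ with hNdef
  have hu : u ≠ 0 := by
    intro h; apply h0; rw [h]; ring
  -- `N ≥ 1`
  have hNpos : 0 < N := WeierstrassCurve.conductorNorm_pos_holds W
  have hN1 : (1 : ℝ) ≤ ((N : ℕ) : ℝ) := by exact_mod_cast hNpos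
  have hNe1 : 1 ≤ ((N : ℕ) : ℝ) ^ e := Real.one_le_rpow hN1 he0
  have hNe0 : 0 ≤ ((N : ℕ) : ℝ) ^ e := zero_le_one.trans hNe1
  -- step 1: `log Δ_min ≤ log 13 + 12 log M`
  have h1 : Real.log ((W.minimalDiscriminantNorm ℤ : ℕ) : ℝ) ≤ Real.log 13 + 12 * Real.log M :=
    FiveTorsionPayoff.log_le_of_le_abs_discForm hu (Nat.cast_nonneg _) hΔ
  -- step 2: `log M ≤ κ' R^e`
  have hRe0 : 0 ≤ R ^ e := Real.rpow_nonneg (Nat.cast_nonneg _) e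
  have h2 : Real.log M ≤ κ' * R ^ e :=
    hlogM.trans (mul_le_mul_of_nonneg_right (le_max_left _ _) hRe0)
  -- step 3: `R^e ≤ 5^e N^e`
  have h3 : R ^ e ≤ (5 : ℝ) ^ e * ((N : ℕ) : ℝ) ^ e :=
    FiveTorsionPayoff.rpow_le_of_dvd_five_mul hNpos hdiv he0
  -- assemble
  have hlog13 : 0 ≤ Real.log 13 := Real.log_nonneg (by norm_num)
  have h5e0 : 0 ≤ (5 : ℝ) ^ e := Real.rpow_nonneg (by norm_num) e
  calc Real.log ((W.minimalDiscriminantNorm ℤ : ℕ) : ℝ)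
      ≤ Real.log 13 + 12 * Real.log M := h1
    _ ≤ Real.log 13 + 12 * (κ' * R ^ e) := by gcongr
    _ ≤ Real.log 13 + 12 * (κ' * ((5 : ℝ) ^ e * ((N : ℕ) : ℝ) ^ e)) := by gcongr
    _ ≤ Real.log 13 * ((N : ℕ) : ℝ) ^ e + 12 * (κ' * ((5 : ℝ) ^ e * ((N : ℕ) : ℝ) ^ e)) := by
        gcongr; exact le_mul_of_one_le_right hlog13 hNe1
    _ = (12 * κ' * (5 : ℝ) ^ e + Real.log 13) * ((N : ℕ) : ℝ) ^ e := by ring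

end Summit.ABC.ABC.Theorems
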